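import Summits.AnomalousDissipation.AnomalousDissipation.Theorems.SawtoothPulseCascadeK1LocalisedCascadeAxisMomentPeriodic
import Summits.AnomalousDissipation.AnomalousDissipation.Theorems.SawtoothPulseCascadeK1LocalisedCascadeSlotAxisDeriv
import Summits.AnomalousDissipation.AnomalousDissipation.Theorems.SawtoothPulseCascadeK1LocalisedCascadeSlotMultiplierData
import Summits.AnomalousDissipation.AnomalousDissipation.Theorems.SawtoothPulseCascadeK1LocalisedCascadeZoneJunk

/-!
# K1loc, line `Spectral` / SeqCone — helper: WIENER MOMENTS OF A PROFILE CUT-OFF FROM SUP BOUNDS AND LAYER MEASURE (S-B, explicit)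

Helper file of the prover lane on the crux `K1LocalisedCascade` (stmt-AnomalousDissipation-19491), route
`SawtoothPulseCascade` (memo v7 §3 rev 2).  The cut-offs of `…EnergyStepH/V.energy_ledger_step_H/_V` are profiles
`x ↦ X(x_j)` with `X : ShearProfile` (`…StripCutoff`, `…AffineProfile`), `1/N_j`-periodic, with derivative profiles bounded by
`C₁, C₂` and supported on the transition layers (circle measure `≤ τ`, `…ZoneJunk`).  For such data this file makes the Wiener
moments that appear as the constants `hωs`, `hω2p`, `hω2s` of the energy ledger EXPLICIT:

* `tsum_moment_le_of_profile` — for `X, X′ = Xd, X″ = Xdd : ShearProfile` (`HasDerivAt` chain), `X(y + 1/N) = X(y)`,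
  `|Xd| ≤ C₁`, `|Xdd| ≤ C₂`, `vol{y ∈ (0,1] : Xd y ≠ 0}, vol{y ∈ (0,1] : Xdd y ≠ 0} ≤ τ`, and a modulus `0 ≤ ω(n) ≤ L|n_j|`: for every
  integer `Q ≥ 1`,  `Σ_n ω(n)‖𝓕(X∘x_j)(n)‖ ≤ (L/2π)·(√(2Q)·C₁√τ + C₂√τ/(N·π√(2Q)))`.
  (Assembled from `…AxisMomentPeriodic.tsum_moment_le_of_axis_periodic`, `…SlotAxisDeriv.mFourierCoeff_comp_eval_periodicLift_deriv`,
  `Torus.mFourierCoeff_comp_eval_eq_zero`, `…ZoneJunk.integral_comp_eval_eq_integral_circle`.)  Optimising `Q` gives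
  `≈ (L/π^{3/2})·√(C₁C₂τ/N)`; for `4N` ramps of width `ℓ` (`τ = 4Nℓ`, `C₁ = c₁/ℓ`, `C₂ = c₂/ℓ²`) this is `(2L/π^{3/2})√(c₁c₂)/ℓ`,
  independent of `N` — the true order of the Wiener norm of `X′`.
Also `integral_sq_onCircle_le` (`∫_{T^d} R(x_j)² ≤ B²·vol{y ∈ (0,1] : R y ≠ 0}`).  No definitions; no statement about the stub.
[cite: Grafakos2014, Prop. 3.1.2 (coefficients of derivatives, translates, functions of one coordinate) and Prop. 3.2.7 (3)] [problem: turb]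
-/

-- `Summit.<Summit>.<Problem>`: single-conjunct summit, the duplicate namespace segment is deliberate.
set_option linter.dupNamespace false

noncomputable section

namespace Summit.AnomalousDissipation.AnomalousDissipation.Theorems.SawtoothPulseCascade.K1Slot

open MeasureTheory Filter Topology Complex UnitAddTorus
open Literature.Analysis Literature.Analysis.FunctionSpaces Literature.Analysis.FunctionSpaces.Torus
open Literature.Analysis.FluidPDE.ShearStage

variable {d : Type*} [Fintype d] [DecidableEq d]

omit [DecidableEq d] in
/-- `∫_{T^d} (R(x_j))² ≤ B²·vol{y ∈ (0,1] : R y ≠ 0}` for a profile `R` with `|R| ≤ B` (torus → circle → `(0,1]`, as in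
`…ZoneJunk.integral_one_sub_sq_le_measureReal`). [folklore] -/
theorem integral_sq_onCircle_le (R : ShearProfile) {B : ℝ} (hB : ∀ y, |R y| ≤ B) (j : d) :
    ∫ x : UnitAddTorus d, ‖(R.onCircle (x j) : ℂ)‖ ^ 2 ≤ B ^ 2 * volume.real {y : ℝ | y ∈ Set.Ioc (0 : ℝ) 1 ∧ R y ≠ 0} := by
  set G : UnitAddCircle → ℝ := fun b => R.onCircle b ^ 2 with hG_def
  have hG : Continuous G := R.continuous_onCircle.pow 2
  have h1' : ∫ x : UnitAddTorus d, ‖(R.onCircle (x j) : ℂ)‖ ^ 2 = ∫ b : UnitAddCircle, G b := by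
    rw [← K1Flat.integral_comp_eval_eq_integral_circle hG j]
    refine integral_congr_ae (ae_of_all _ fun x => ?_)
    simp only [hG_def, Complex.norm_real, Real.norm_eq_abs, sq_abs]
  rw [h1', ← UnitAddCircle.integral_preimage 0 G, zero_add]
  set Z : Set ℝ := {y : ℝ | R y ≠ 0} with hZ_def
  have hZm : MeasurableSet Z := (isClosed_eq R.continuous continuous_const).measurableSet.compl
  have hB0 : 0 ≤ B := (abs_nonneg _).trans (hB 0)
  have hGcoe : ∀ a : ℝ, G (a : UnitAddCircle) = R a ^ 2 := fun a => by simp only [hG_def, ShearProfile.onCircle_coe]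
  have hle : ∀ a ∈ Set.Ioc (0 : ℝ) 1, G (a : UnitAddCircle) ≤ Z.indicator (fun _ => B ^ 2) a := by
    intro a _
    rw [hGcoe]
    by_cases ha : a ∈ Z
    · rw [Set.indicator_of_mem ha, ← sq_abs]; exact pow_le_pow_left₀ (abs_nonneg _) (hB a) 2
    · rw [Set.indicator_of_notMem ha]
      have : R a = 0 := by simpa [hZ_def] using ha
      rw [this]; norm_num
  have hGc' : Continuous fun a : ℝ => G (a : UnitAddCircle) := hG.comp (AddCircle.continuous_mk' 1)
  have hint1 : IntegrableOn (fun a : ℝ => G (a : UnitAddCircle)) (Set.Ioc 0 1) volume :=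
    (hGc'.integrableOn_Icc (a := 0) (b := 1)).mono_set Set.Ioc_subset_Icc_self
  have hint2 : IntegrableOn (Z.indicator (fun _ => B ^ 2 : ℝ → ℝ)) (Set.Ioc 0 1) volume := by
    refine Integrable.indicator ?_ hZm
    exact integrableOn_const (by rw [Real.volume_Ioc]; exact ENNReal.ofReal_ne_top)
  calc ∫ a in Set.Ioc (0 : ℝ) 1, G (a : UnitAddCircle) ≤ ∫ a in Set.Ioc (0 : ℝ) 1, Z.indicator (fun _ => B ^ 2) a :=
        setIntegral_mono_on hint1 hint2 measurableSet_Ioc hle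
    _ = B ^ 2 * (volume.restrict (Set.Ioc (0 : ℝ) 1)).real Z := by
        rw [integral_indicator hZm, setIntegral_const, smul_eq_mul, mul_comm]
    _ = B ^ 2 * volume.real (Z ∩ Set.Ioc 0 1) := by rw [measureReal_restrict_apply hZm]
    _ = B ^ 2 * volume.real {y : ℝ | y ∈ Set.Ioc (0 : ℝ) 1 ∧ R y ≠ 0} := by
        congr 2; ext y; simp only [hZ_def, Set.mem_inter_iff, Set.mem_setOf_eq]; tauto

/-- **Wiener moments of a profile cut-off, explicitly.**  See the module docstring. [cite: Grafakos2014, Prop. 3.1.2 and Prop. 3.2.7 (3)] -/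
theorem tsum_moment_le_of_profile (X Xd Xdd : ShearProfile) (hXd : ∀ y, HasDerivAt X (Xd y) y)
    (hXdd : ∀ y, HasDerivAt Xd (Xdd y) y) (j : d) {N : ℕ} (hN : 1 ≤ N) (hper : ∀ y : ℝ, X (y + 1 / N) = X y)
    {C₁ C₂ τ : ℝ} (hC₁ : ∀ y, |Xd y| ≤ C₁) (hC₂ : ∀ y, |Xdd y| ≤ C₂)
    (hτ₁ : volume.real {y : ℝ | y ∈ Set.Ioc (0 : ℝ) 1 ∧ Xd y ≠ 0} ≤ τ)
    (hτ₂ : volume.real {y : ℝ | y ∈ Set.Ioc (0 : ℝ) 1 ∧ Xdd y ≠ 0} ≤ τ)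
    {ω : (d → ℤ) → ℝ} {L : ℝ} (hL : 0 ≤ L) (hω0 : ∀ n, 0 ≤ ω n) (hω : ∀ n, ω n ≤ L * |((n j : ℤ) : ℝ)|)
    {Q : ℕ} (hQ : 1 ≤ Q) :
    (Summable fun n => ω n * ‖mFourierCoeff (fun x : UnitAddTorus d => (X.onCircle (x j) : ℂ)) n‖) ∧
      ∑' n, ω n * ‖mFourierCoeff (fun x : UnitAddTorus d => (X.onCircle (x j) : ℂ)) n‖ ≤
        L / (2 * Real.pi) * (Real.sqrt (2 * Q) * (C₁ * Real.sqrt τ) +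
          C₂ * Real.sqrt τ / ((N : ℝ) * (Real.pi * Real.sqrt (2 * Q)))) := by
  have hπ : 0 < Real.pi := Real.pi_pos
  have hC₁0 : 0 ≤ C₁ := (abs_nonneg _).trans (hC₁ 0)
  have hC₂0 : 0 ≤ C₂ := (abs_nonneg _).trans (hC₂ 0)
  have hτ0 : 0 ≤ τ := le_trans measureReal_nonneg hτ₁
  -- the three torus functions
  set F₀ : UnitAddTorus d → ℂ := fun x => (X.onCircle (x j) : ℂ) with hF₀
  set F₁ : UnitAddTorus d → ℂ := fun x => (Xd.onCircle (x j) : ℂ) with hF₁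
  set F₂ : UnitAddTorus d → ℂ := fun x => (Xdd.onCircle (x j) : ℂ) with hF₂
  have hcont : ∀ (R : ShearProfile), Continuous fun x : UnitAddTorus d => (R.onCircle (x j) : ℂ) := fun R =>
    Complex.continuous_ofReal.comp (R.continuous_onCircle.comp (continuous_apply j))
  -- periodic lifts of the complexified profiles and their identification with `onCircle`
  have hpC : ∀ (R : ShearProfile), Function.Periodic (fun y : ℝ => (R y : ℂ)) 1 := fun R y => by
    simp only []; rw [R.periodic y]
  have hlift : ∀ (R : ShearProfile), (fun b : UnitAddCircle => (R.onCircle b : ℂ)) = (hpC R).lift := fun R =>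
    circleFun_eq_of_coe fun y => by rw [ShearProfile.onCircle_coe, Function.Periodic.lift_coe]
  have hfun : ∀ (R : ShearProfile), (fun x : UnitAddTorus d => (R.onCircle (x j) : ℂ)) =
      fun x : UnitAddTorus d => ((hpC R).lift : UnitAddCircle → ℂ) (x j) := fun R => by
    funext x; exact congr_fun (hlift R) (x j)
  -- derivative coefficient relations
  have h1 : ∀ n : d → ℤ, mFourierCoeff F₁ n = (2 * Real.pi * Complex.I * (n j)) * mFourierCoeff F₀ n := by
    intro n
    rw [hF₁, hF₀, hfun Xd, hfun X]
    exact mFourierCoeff_comp_eval_periodicLift_deriv (hpC X) (hpC Xd) (fun y => (hXd y).ofReal_comp)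
      (Complex.continuous_ofReal.comp Xd.continuous) j n
  have h2 : ∀ n : d → ℤ, mFourierCoeff F₂ n = (2 * Real.pi * Complex.I * (n j)) * mFourierCoeff F₁ n := by
    intro n
    rw [hF₂, hF₁, hfun Xdd, hfun Xd]
    exact mFourierCoeff_comp_eval_periodicLift_deriv (hpC Xd) (hpC Xdd) (fun y => (hXdd y).ofReal_comp)
      (Complex.continuous_ofReal.comp Xdd.continuous) j n
  -- support: axis and the lattice `Nℤ`
  have hsupp : ∀ n : d → ℤ, mFourierCoeff F₀ n ≠ 0 → (∀ l, l ≠ j → n l = 0) ∧ (N : ℤ) ∣ n j := by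
    intro n hn
    refine ⟨fun l hl => ?_, ?_⟩
    · by_contra h
      exact hn (mFourierCoeff_comp_eval_eq_zero (fun b : UnitAddCircle => (X.onCircle b : ℂ)) j hl h)
    · by_contra h
      refine hn (mFourierCoeff_eq_zero_of_axis_periodic (i := j) hN (fun x => ?_) h)
      simp only [hF₀, Pi.add_apply, Pi.single_eq_same]
      obtain ⟨y, hy⟩ := QuotientAddGroup.mk_surjective (x j)
      rw [← hy]
      have : ((y : UnitAddCircle) + (((1 : ℝ) / N : ℝ) : UnitAddCircle)) = ((y + 1 / N : ℝ) : UnitAddCircle) := by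
        norm_cast
      rw [this, ShearProfile.onCircle_coe, ShearProfile.onCircle_coe, hper]
  -- the moment bound with abstract `L²` norms
  have hmain := tsum_moment_le_of_axis_periodic (X := F₀) (hcont Xd) (hcont Xdd) j hN hsupp h1 h2 hL hω0 hω hQ
  refine ⟨hmain.1, hmain.2.trans ?_⟩
  -- the `L²` norms: `∫‖F₁‖² ≤ C₁² τ`, `∫‖F₂‖² ≤ C₂² τ`
  have hL2 : ∀ (R : ShearProfile) {C : ℝ}, (∀ y, |R y| ≤ C) →
      volume.real {y : ℝ | y ∈ Set.Ioc (0 : ℝ) 1 ∧ R y ≠ 0} ≤ τ →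
      Real.sqrt (∫ x : UnitAddTorus d, ‖(R.onCircle (x j) : ℂ)‖ ^ 2) ≤ C * Real.sqrt τ := by
    intro R C hC hτR
    have hC0 : 0 ≤ C := (abs_nonneg _).trans (hC 0)
    calc Real.sqrt (∫ x : UnitAddTorus d, ‖(R.onCircle (x j) : ℂ)‖ ^ 2) ≤ Real.sqrt (C ^ 2 * τ) :=
          Real.sqrt_le_sqrt ((integral_sq_onCircle_le R hC j).trans (mul_le_mul_of_nonneg_left hτR (sq_nonneg _)))
      _ = C * Real.sqrt τ := by rw [Real.sqrt_mul (sq_nonneg _), Real.sqrt_sq hC0]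
  have hA := hL2 Xd hC₁ hτ₁
  have hB := hL2 Xdd hC₂ hτ₂
  refine mul_le_mul_of_nonneg_left (add_le_add ?_ ?_) (by positivity)
  · exact mul_le_mul_of_nonneg_left hA (Real.sqrt_nonneg _)
  · exact div_le_div_of_nonneg_right hB (by positivity)

end Summit.AnomalousDissipation.AnomalousDissipation.Theorems.SawtoothPulseCascade.K1Slot
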